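import Mathlib
import HarnessLib
import HarnessLib.Audit
import Summits.Schanuel.Statement

/-!
Route: MoebiusRung

CLOSED (retired) 2026-08-15T13:51:24Z by operator:999:1257524 — reason: not-a-thesis: assembly does not conclude the sub-problem Statement — note: D-0027 §2.1 audit (human 2026-08-15: routes that do not decide the summit are removed): the assembly concludes `Target`, not the sub-problem statement; a NEW conforming route may be opened from the same idea (generated `closes : … → _root_.Schanuel`).. The file is kept as the record of this route; refuted decls are indexed as negative knowledge (`ledger negatives`).

# Route MoebiusRung — the (1,1)-rung of e⊥π by PGL₂(ℚ)-covariance of continued fractions — 1, e, π,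
eπ ℚ-independent from any Gauss-typicality of π (sector route)

SECTOR ROUTE, said plainly: the target X is far BELOW the summit and does not imply it. X (decl
`Target`) = "1, e, π, eπ are
ℚ-linearly independent" — the bidegree-(1,1) rung of e ⊥ π: Schanuel →
`ExpOnePiAlgebraicIndependent` → X (support
`RungOfSchanuel`), and X → `ExpOneAddPiIrrational ∧ ExpOneMulPiIrrational`, the two registered OPEN
statements periods.S15
(support `RungGivesIrrationality`); X ↛ Schanuel. Elementary reformulation (support
`MoebiusFormOfRung`): X ⟺ π ∉ PGL₂(ℚ)·e,
i.e. π ≠ (ae+b)/(ce+d) for integers with ad − bc ≠ 0. It suffices, for X, to show EITHER of two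
properties of π's regular
continued fraction, each of which no nonsingular integer Möbius image of e = [2; 1,2,1, 1,4,1,
1,6,1, …] can have:
`PiNotHurwitzian` (RCF(π) is not eventually an interlacing of arithmetic progressions; cash-out via
Hurwitz's 1896 closure
theorem, support `HurwitzMoebiusOfExpOne`) OR `PiLogApproximable` (π has infinitely many rational
approximations with
|π − p/q| < 1/(q² log q); cash-out via Euler's expansion of e, a Davis-type finiteness lemma and an
elementary Möbius transfer,
supports `EulerContinuedFraction`, `ExpOneLogApproxFinite`, `MoebiusPreservesLogApproxFinite`). Card
realised:
Schanuel/Schanuel/moebius-rung-continued-fractions (spine; its retired duplicates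
bilinear-rung-hurwitz-cf-pgl2 and
e-pi-linear-rung-numeration-faces are absorbed).
Lean: `LinearIndependent ℚ ![(1 : ℝ), Real.exp 1, Real.pi, Real.exp 1 * Real.pi]`

## Assembly
Pure logic (kernel-checked in the planner's Sketch.lean, `assembly_holds`, axioms
propext/Classical.choice/Quot.sound): by
MoebiusFormOfRung it is enough to refute π = (ae+b)/(ce+d) with ad − bc ≠ 0. Structural face:
HurwitzMoebiusOfExpOne makes
RCF(π) = RCF((ae+b)/(ce+d)) eventually interlaced arithmetic progressions, contradicting
PiNotHurwitzian. Metric face: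
ExpOneLogApproxFinite and MoebiusPreservesLogApproxFinite (x = e) make {q : ∃ p, |π − p/q| < 1/(q²
log q)} finite, hence
bounded, contradicting PiLogApproximable. Either crux alone suffices; the disjunction records that
the two faces are
independent alternatives, not consecutive steps. The conclusion is the sector target X (`Target`),
NOT the summit: the only
arrow touching `Schanuel` is the support RungOfSchanuel, in the direction Schanuel → X.

Rationale: WHY THIS LINE. Mechanism: a ℚ-linear relation a + be + cπ + d·eπ = 0 is exactly π = −(a+be)/(c+de),
so the lowest MIXED rung of e ⊥ π is the
statement that π is not a rational Möbius image of e; the regular continued fraction is covariant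
under nonsingular integer
Möbius maps (finite transducers, Raney1973; closure of Hurwitz's progression class, Hurwitz1896,
HartonoKraaikamp2002,
MatthewsWalters1970; matrix-invariance of CF-normality, Vandehey2017 Thm 1.1) and e's expansion is
known exactly (Euler;
Cohn2006), with its approximation function known exactly (Davis1978: |e − p/q| ≍ log log q/(q² log
q) at best). Hence ANY
transducer-robust property of RCF(π) that the images of [2; 1,2,1,1,4,1,…] lack proves X — with no
auxiliary function, no zero
estimate and no comparison of a transcendence measure against an approximation exponent (the
quantitative shadow of ¬X is a
simultaneous approximation of e and π to quality log log H/(H² log H) along e's convergent heights,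
a race no method runs at
exponent 2: μ(π) ≤ 7.103, ZeilbergerZudilin2020). Imported area: the metric and combinatorial theory
of the Gauss map
(Khinchin1964) pointed at the weakest open question on (e, π), the irrationality of e + π
(Waldschmidt2004 §2.3, Rivoal2024
p. 204, Angell2021 §1.4). What it does that the other Schanuel routes (RigidCore, ExpMordellWeil,
Zilber, RoyCriterion,
AlgIndepMethod) do not: they live in the exponential-field / auxiliary-polynomial language, where by
the Bays–Kirby barrier
nothing separates (e, π) from a pair (ε, τ) with P(ε, τ) = 0; the ORDER structure of ℝ (RCF = the
GL₂(ℤ)-geometry of the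
lattice ℤ + ℤx) is an input invisible to that language. Yield toward the summit is nil by design;
the periphery (Euler's
continued fraction of e — absent from Mathlib —, Davis-type finiteness, Möbius transfer, Schanuel →
X → e+π, eπ ∉ ℚ) is
kernel-checkable now and of independent value; both cruxes are bare open statements about RCF(π) and
the header says so.

RANKED CRUXES. #0 Target (target) — 1, e, π, eπ are linearly independent over ℚ (equivalently: π ∉
PGL₂(ℚ)·e; card item (0)). (why it might fail: believed (a consequence of Schanuel), but open: even
e + π ∉ ℚ is open, and no known method separates π from the countable set PGL₂(ℚ)·e.)
[Waldschmidt2004, Rivoal2024, Angell2021, BakerTNT1975]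
#2 PiNotHurwitzian (crux) — the regular continued fraction of π is not, from some index n₀ on, an
interlacing of r ≥ 1 arithmetic progressions αᵢm + βᵢ (π is not a Hurwitz continued fraction of
order ≤ 1); with HurwitzMoebiusOfExpOne and MoebiusFormOfRung it excludes π from PGL₂(ℚ)·e, hence X
(card item C1, face (c), sharpened as the triage asked: only e's own order-1 pattern class matters,
and this crux kills the whole class). [difficulty: open-problem] (why it might fail: engine-less:
nothing structural is known about RCF(π) beyond ~3·10¹⁰ computed quotients (even unboundedness is
open), and order-1 Hurwitz numbers (Bessel/₀F₁ quotients; Lehmer, Komatsu families) carry no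
transcendence proxy that would exclude π.) [Hurwitz1896, Komatsu2003, HartonoKraaikamp2002,
MatthewsWalters1970]
#3 PiLogApproximable (crux) — for every Q there are integers p and q > Q with |π − p/q| < 1/(q² log
q) — π is not "log-badly approximable" (Lebesgue-a.e. true by Khinchin's theorem since Σ 1/(q log q)
diverges; for e it FAILS by Davis1978); with ExpOneLogApproxFinite, MoebiusPreservesLogApproxFinite
and MoebiusFormOfRung it gives X (card items (d), (3); no transducer needed: Möbius maps move
rational approximations by bounded height distortion). [difficulty: open-problem] (why it might
fail: π may sit in the null but full-dimension class of log-badly approximable numbers (which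
contains e): a solution needs a_{n+1}(π) ≳ log q_n(π) ≈ 1.19 n, seen only a handful of times among
3·10¹⁰ known quotients; μ(π) ≤ 7.103 is silent at exponent 2.) [Khinchin1964, Davis1978,
ZeilbergerZudilin2020]
#9 MoebiusFormOfRung (support) — X ⟺ for all integers a, b, c, d with ad − bc ≠ 0 and ce + d ≠ 0, π
≠ (ae + b)/(ce + d) (linear algebra; ← uses `irrational_pi` (Mathlib) for the det = 0 case and the
irrationality of e, tree `Literature.NumberTheory.Transcendental.transcendental_exp_one_holds`, for
the case c + de = 0; card item S1). [difficulty: provable-now] [Waldschmidt2004]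
#9 RungOfSchanuel (support) — Schanuel's conjecture implies X (via
`Literature.Barriers.Schanuel.expOnePiAlgebraicIndependent_of_schanuel`: e, π algebraically
independent, and a + bX + cY + dXY is a nonzero polynomial; card item S1). [difficulty:
provable-now] [BakerTNT1975, Waldschmidt2000]
#9 RungGivesIrrationality (support) — X implies the two registered open statements periods.S15: e +
π and eπ are irrational (a rational value is a nontrivial ℚ-relation among 1, e, π, eπ; card
Assembly sketch). [difficulty: provable-now] [Waldschmidt2004, Angell2021, Rivoal2024]
#9 EulerContinuedFraction (support) — Euler's regular continued fraction e = [2; 1, 2, 1, 1, 4, 1,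
1, 6, 1, …]: integer part 2 and n-th partial denominator (0-based) equal to 2(⌊n/3⌋ + 1) if n ≡ 1
(mod 3), else 1 — in Mathlib's `GenContFract.of` (theorem in print, absent from Mathlib; Cohn's
six-integral proof is the short road; card item S2). [difficulty: L] [Cohn2006, Khinchin1964]
#9 ExpOneLogApproxFinite (support) — for every real C only finitely many q admit an integer p with
|e − p/q| < C/(q² log q) (weak, constant-free form of Davis1978: from EulerContinuedFraction, log
q_n(e) ≍ n log n while a_{n+1}(e) ≤ n, plus Legendre's theorem `Real.exists_rat_eq_convergent`; card
items (2), D). [difficulty: M] [Davis1978, Cohn2006]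
#9 MoebiusPreservesLogApproxFinite (support) — if x has, for every C, only finitely many C/(q² log
q)-approximations, then so does (ax + b)/(cx + d) for integers a, b, c, d with ad − bc ≠ 0 and cx +
d ≠ 0 (elementary: pull an approximation p/q of the image back through the inverse map; heights
change by a bounded factor, errors by a bounded factor; card lemma D in the form actually needed).
[difficulty: M] [Khinchin1964, Raney1973]
#9 HurwitzMoebiusOfExpOne (support) — for integers a, b, c, d with ad − bc ≠ 0 (and ce + d ≠ 0) the
regular continued fraction of (ae + b)/(ce + d) is, from some index on, an interlacing of arithmetic
progressions with natural-number coefficients (Hurwitz's 1896 theorem: the class of Hurwitz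
continued fractions is stable under nonsingular integer Möbius maps, orders preserved; e is
Hurwitzian of order 1 by EulerContinuedFraction; explicit for (m/n)e^{1/q} in MatthewsWalters1970; a
grounder may vendor Hurwitz's theorem as a Literature fact and close this by citation; card item
S2). [difficulty: L] [Hurwitz1896, MatthewsWalters1970, HartonoKraaikamp2002, Raney1973]

TWO-LAYER PLAN. Foreseen glued splits, none filed now (k ≤ 3, depth 1): PiNotHurwitzian ⇐ (RCF(π)
has lim sup a_k/k ∈ {0, ∞}) → (transducer
index comparability: order-1 progressions survive with positive linear density) → PiNotHurwitzian;
PiLogApproximable ⇐ (a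
Lévy-type statement: lim inf log q_n(π)/n < ∞) → (a_{n+1}(π) > 2 log q_n(π) infinitely often) →
PiLogApproximable;
HurwitzMoebiusOfExpOne ⇐ (Hurwitz's theorem as a vendored Literature fact for order-1 Hurwitz
continued fractions) →
(EulerContinuedFraction) → HurwitzMoebiusOfExpOne.

KILL CRITERIA. Refutation of Target (an integer relation among 1, e, π, eπ) refutes Schanuel itself
— close `refuted:Target` and hand the
witness to the summit. PiNotHurwitzian refuted (RCF(π) provably eventually interlaced progressions)
with a pattern that IS a
Möbius image of e's kills X and Schanuel; with any other pattern it kills only crux 2 — pivot to the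
metric face alone (restate
the assembly without the disjunct). PiLogApproximable refuted (π log-badly approximable) kills only
crux 3 — pivot to the
structural face. A refuter showing HurwitzMoebiusOfExpOne or ExpOneLogApproxFinite MISSTATED (index
conventions of
`GenContFract.of`, edge cases q ≤ 1) forces a restate, not a close. X proved elsewhere (e.g. from an
E∩G-type theorem) moots
the route: close superseded.

NOT DECOMPOSED YET. The E-function face (card face (5): π is not a quotient of two E-values,
`Literature.Barriers.Schanuel.eValues`; implies X
since a + be ∈ 𝐄) is deliberately NOT filed at open — it needs the Barriers import cone and belongs
with the E∩G programme
(Rivoal2024 Problème 10); a tenure pass may add it as a third alternative crux. Not filed either: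
CF-normality of π (needs a
`CFNormal` definition; Vandehey2017 invariance would be the cash-out), bad approximability of π
(believed FALSE for π, so not a
useful sufficient condition), the Lévy/Khinchin-statistics face (e), the transducer lemma D in
Raney's generality, the
unconditional by-products "1, e, ν, eν ℚ-independent for every badly approximable / CF-normal ν"
(support-grade, may ride
with `--supports Target`), and any bidegree beyond (1,1) (x ↦ x², x³ leave the Hurwitz class: the
method's ceiling).

CHEAPEST FALSIFIER. (1) Lookup, run by the card author, the triage refuter and this planner: is "π
not Hurwitzian / π not badly-or-log-badly
approximable ⇒ e + π irrational" or "1, e, ν, eν independent for badly approximable ν" already in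
print? Vandehey2017 p. 3
prints that no property-transfer result of this kind is known; galaxy/zbMATH/crossref found none —
if one surfaces, the
grade drops to known but nothing is refuted. (2) kit, cheap: from the published 3·10¹⁰ partial
quotients of π, (a) certify
that no window [n₀, 3·10¹⁰) is an interlacing of ≤ r progressions for r ≤ 10⁶ (evidence for crux 2
and a certified "X unless
the Möbius matrix or the pattern onset is astronomically large"), (b) list the n with a_{n+1}(π) >
log q_n(π) (each is a
solution of crux 3's inequality; a typical number shows ≈ 1.2 ln N ≈ 29 of them by N = 3·10¹⁰ — far
fewer would make crux 3
look special for π), (c) PSLQ on (1, e, π, eπ) at 10⁴ digits: no relation below height ~10^2500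
(evidence for X). Not run
here: the hub is compute-free and kit was not needed to type the route; recommended as the refuter's
first move.

NUMBERS. e = [2; 1, 2, 1, 1, 4, 1, 1, 6, 1, …], a_{3m−1} = 2m (1-based), log q_n(e) ~ (n/3) log n;
Davis1978: |e − p/q| < (½+ε) log log q
/(q² log q) infinitely often and > (½−ε) log log q/(q² log q) for q large. π = [3; 7, 15, 1, 292, 1,
…]: ~3·10¹⁰ quotients
computed; Lévy constant for a.e. x: log q_n/n → π²/(12 log 2) ≈ 1.1866; Gauss measure P(a ≥ k) =
log₂(1 + 1/k); μ(π) ≤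
7.103205 (ZeilbergerZudilin2020); μ(e) = 2. Items at open: 11 (1 target, 2 cruxes, 7 support, 1
assembly).

DEFINITION REQUESTS. None for Lean notions: `GenContFract.of`, `.partDens`, `.h`,
`Real.exists_rat_eq_convergent` (Legendre) are in Mathlib. Cite
fact wanted (to be filed with `ledger workitem add --kind cite` once the gate is reachable): "fact:
Hurwitz 1896 — the class of
regular continued fractions whose partial quotients are eventually interlaced arithmetic
progressions (order ≤ 1) is stable
under x ↦ (ax+b)/(cx+d), a, b, c, d ∈ ℤ, ad − bc ≠ 0" (Hurwitz1896; HartonoKraaikamp2002 Thm 1;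
Perron, Kettenbrüche I §34),
which would let HurwitzMoebiusOfExpOne close from EulerContinuedFraction by citation.

Novelty: Searches (2026-08-15, this planner, on top of the card's and the triage refuter's logged searches):
`lit search --source
crossref "rational approximations to e Davis 1978"` (1 relevant: doi:10.1017/s1446788700021480);
`lit search --source crossref
"short proof simple continued fraction expansion of e Cohn"` (doi:10.1080/00029890.2006.11920278,
Osler doi:10.2307/27641838);
`lit search --source crossref "Raney continued fractions finite automata"` (doi:10.1007/bf01355980);
`lit search --hybrid
"Hurwitz continued fraction arithmetic progression e Möbius transformation"` over held books (12
docs: Angell2022, Rockett–Szüsz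
1994, Khinchin1964, Karpenkov 2013 — none treats Hurwitz-class closure or an (e, π) application;
Rockett–Szüsz "theorem of
Hurwitz" is the √5 theorem); `lit vsearch "linear independence of 1, e, pi, e*pi; pi a Möbius image
of e"` (0 relevant in 12);
`lit galaxy search "Hurwitzian continued fraction" --star all` (3 rows: Bumby–Flahive
arXiv:0710.0399 on inhomogeneous
approximation of Hurwitzian numbers, no e–π use); zbMATH/OpenAlex/S2/arXiv remote tiers rate-limited
(429) this session — the
card's own zbMATH/galaxy sweep ("irrationality of e+π", "e+π is irrational": 0 hits) and the
refuter's (galaxy bm25/substring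
0, zbMATH 0) stand. `ledger negatives --problem Schanuel`: 0. Nearest prior art found: Vandehey2017
(arXiv:1504.05121, Thm 1.1:
nonsingular integer matrices preserve CF-normality; p. 3: no property-transfer results known),
Hurwitz1896 /
HartonoKraaikamp  [refs: 10.1017/s1446788700021480, 10.1080/00029890.2006.11920278, 10.2307/27641838, 10.1007/bf01355980, 10.3836/tjm/1244208859:, 10.1017/s0305004100057108:, 0710.0399, 1504.05121, doi:10.1017/s1446788700021480, doi:10.1080/00029890.2006.11920278, doi:10.2307/27641838, doi:10.1007/bf01355980, doi:10.3836/tjm/1244208859, doi:10.1017/s0305004100057108, Khinchin1964, Vandehey2017, HartonoKraaikamp2002, Matth]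

Barriers (technique_class: continued-fractions gauss-map-invariants): - technique_class: continued-fractions gauss-map-invariants
- Literature.Barriers.Schanuel.EFunctionValuesAtAlgebraicPoints: not met — no E-function or
Siegel–Shidlovskii step is used; the E-face of the rung (π ∉ Frac 𝐄) is deliberately left unfiled
(see Not decomposed yet) precisely because it sits inside this barrier's conjectural complement
(ExpAddPiNotEValue-type statements).
- Literature.Barriers.Schanuel.AxiomsDoNotForceSchanuel: evaded by construction — the input (the
order/lattice structure of ℝ read through the regular continued fraction) is not expressible in the
exponential-field language of Bays–Kirby's 𝔹_P, which is exactly why a CF hypothesis on π can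
distinguish (e, π) from a pair with P(ε, τ) = 0; consistent with the barrier, not in tension with
it.
- Literature.Barriers.Schanuel.AxSchanuelFunctionalNotNumerical: not met — no
functional-transcendence input; the cruxes are numerical statements about one real number.
- Literature.Barriers.Schanuel.SchanuelPropertyNotFirstOrder: not met — nothing is transferred
between models; consistent (RCF data are not first-order in (ℂ, +, ·, exp)).
- Literature.Barriers.Schanuel.AlgebraicIndependenceOfLogarithms: not met — no linear forms in
logarithms; the target is a ℚ-bilinear statement in (1, e) ⊗ (1, π), below every strength threshold
of Baker's method, and the route does not claim to reach log-independence.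
- Literature.Barriers.Schanuel.LinearSubgroupMethodLimit: not met — no auxiliary polynomial, no
linear subgroup t

Novelty grade: new-combination — ROUTE REVIEW (refuter rreview c3531e67). Retired 13:51Z not-a-thesis — CORRECT under D-0027 §2.1: declared sector route, Assembly concludes Target (ℚ-independence of 1,e,π,eπ) strictly below Schanuel, only arrow Schanuel → Target (not an abbrev false positive like FeshbachMemory & 163 others in Atom (refuter refuter-rreview-route-AtomisticToContinu-c3531e67-0, 2026-08-15T13:52:13Z; prior: Hurwitz1896, doi:10.1007/bf01355980 (Raney1973), arXiv:1504.05121 (Vandehey2017), doi:10.1017/s1446788700021480 (Davis1978), Waldschmidt2004)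

History (route lifecycle, newest last):
- 2026-08-15T13:51:24Z · CLOSED retired — not-a-thesis: assembly does not conclude the sub-problem Statement (operator:999:1257524)

sub-problem: Schanuel · status: closed(retired) · opened planner-plancard-Schanuel-Schanuel-moebius-ru-5b881dc7-0 2026-08-15T11:43:12Z · rev 0 · ledger route-Schanuel-MoebiusRung
GENERATED by the gate from the ledger (D-0016/17). Provers cite these decls: `theorem foo : Summit.Schanuel.Schanuel.Theses.MoebiusRung.<Decl> := …` in Summits/Schanuel/Schanuel/Theorems/<Name>.lean.
-/

namespace Summit.Schanuel.Schanuel.Theses.MoebiusRung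

open scoped BigOperators Topology Manifold Classical MeasureTheory ProbabilityTheory Matrix InnerProductSpace ComplexConjugate ContinuousMap
open Filter Set Function TopologicalSpace MeasureTheory

attribute [summit_statement] _root_.Schanuel

open Literature.Periods

/-- item stmt-Schanuel-5869 · target · rank 0 · closed · moot by None · by planner
why it might fail: believed (a consequence of Schanuel), but open: even e + π ∉ ℚ is open, and no known method separates π from the countable set PGL₂(ℚ)·e.
sources: Waldschmidt2004, Rivoal2024, Angell2021, BakerTNT1975
[target] 1, e, π, eπ are linearly independent over ℚ (equivalently: π ∉ PGL₂(ℚ)·e; card item (0)). -/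
@[route_item "route-Schanuel-MoebiusRung"]
def Target : Prop :=
  LinearIndependent ℚ ![(1 : ℝ), Real.exp 1, Real.pi, Real.exp 1 * Real.pi]

/-- item stmt-Schanuel-5870 · crux · rank 2 · closed · moot by None · by planner
why it might fail: engine-less: nothing structural is known about RCF(π) beyond ~3·10¹⁰ computed quotients (even unboundedness is open), and order-1 Hurwitz numbers (Bessel/₀F₁ quotients; Lehmer, Komatsu families) carry no transcendence proxy that would exclude π.
sources: Hurwitz1896, Komatsu2003, HartonoKraaikamp2002, MatthewsWalters1970
[crux] the regular continued fraction of π is not, from some index n₀ on, an interlacing of r ≥ 1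
arithmetic progressions αᵢm + βᵢ (π is not a Hurwitz continued fraction of order ≤ 1); with
HurwitzMoebiusOfExpOne and MoebiusFormOfRung it excludes π from PGL₂(ℚ)·e, hence X (card item C1,
face (c), sharpened as the triage asked: only e's own order-1 pattern class matters, and this crux
kills the whole class). [difficulty: open-problem] -/
@[route_item "route-Schanuel-MoebiusRung"]
def PiNotHurwitzian : Prop :=
  ¬ ∃ (n₀ r : ℕ) (α β : Fin r → ℕ), 0 < r ∧ ∀ (m : ℕ) (i : Fin r), (GenContFract.of Real.pi).partDens.get? (n₀ + r * m + i) = some ((α i * m + β i : ℕ) : ℝ)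

/-- item stmt-Schanuel-5871 · crux · rank 3 · closed · moot by None · by planner
why it might fail: π may sit in the null but full-dimension class of log-badly approximable numbers (which contains e): a solution needs a_{n+1}(π) ≳ log q_n(π) ≈ 1.19 n, seen only a handful of times among 3·10¹⁰ known quotients; μ(π) ≤ 7.103 is silent at exponent 2.
sources: Khinchin1964, Davis1978, ZeilbergerZudilin2020
[crux] for every Q there are integers p and q > Q with |π − p/q| < 1/(q² log q) — π is not
"log-badly approximable" (Lebesgue-a.e. true by Khinchin's theorem since Σ 1/(q log q) diverges; for
e it FAILS by Davis1978); with ExpOneLogApproxFinite, MoebiusPreservesLogApproxFinite and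
MoebiusFormOfRung it gives X (card items (d), (3); no transducer needed: Möbius maps move rational
approximations by bounded height distortion). [difficulty: open-problem] -/
@[route_item "route-Schanuel-MoebiusRung"]
def PiLogApproximable : Prop :=
  ∀ Q : ℕ, ∃ p : ℤ, ∃ q : ℕ, Q < q ∧ |Real.pi - p / q| < 1 / ((q : ℝ) ^ 2 * Real.log q)

/-- item stmt-Schanuel-5872 · support · rank 9 · closed · moot by None · by planner
sources: Waldschmidt2004
[support] X ⟺ for all integers a, b, c, d with ad − bc ≠ 0 and ce + d ≠ 0, π ≠ (ae + b)/(ce + d)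
(linear algebra; ← uses `irrational_pi` (Mathlib) for the det = 0 case and the irrationality of e,
tree `Literature.NumberTheory.Transcendental.transcendental_exp_one_holds`, for the case c + de = 0;
card item S1). [difficulty: provable-now] -/
@[route_item "route-Schanuel-MoebiusRung"]
def MoebiusFormOfRung : Prop :=
  Target ↔ ∀ a b c d : ℤ, a * d - b * c ≠ 0 → (c : ℝ) * Real.exp 1 + d ≠ 0 → Real.pi ≠ (a * Real.exp 1 + b) / (c * Real.exp 1 + d)

/-- item stmt-Schanuel-5873 · support · rank 9 · closed · moot by None · by planner
sources: BakerTNT1975, Waldschmidt2000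
[support] Schanuel's conjecture implies X (via
`Literature.Barriers.Schanuel.expOnePiAlgebraicIndependent_of_schanuel`: e, π algebraically
independent, and a + bX + cY + dXY is a nonzero polynomial; card item S1). [difficulty:
provable-now] -/
@[route_item "route-Schanuel-MoebiusRung"]
def RungOfSchanuel : Prop :=
  Schanuel → Target

/-- item stmt-Schanuel-5874 · support · rank 9 · closed · moot by None · by planner
sources: Waldschmidt2004, Angell2021, Rivoal2024
[support] X implies the two registered open statements periods.S15: e + π and eπ are irrational (a
rational value is a nontrivial ℚ-relation among 1, e, π, eπ; card Assembly sketch). [difficulty: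
provable-now] -/
@[route_item "route-Schanuel-MoebiusRung"]
def RungGivesIrrationality : Prop :=
  Target → Literature.NumberTheory.Transcendental.ExpOneAddPiIrrational ∧ Literature.NumberTheory.Transcendental.ExpOneMulPiIrrational

/-- item stmt-Schanuel-5875 · support · rank 9 · closed · moot by None · by planner
sources: Cohn2006, Khinchin1964
[support] Euler's regular continued fraction e = [2; 1, 2, 1, 1, 4, 1, 1, 6, 1, …]: integer part 2
and n-th partial denominator (0-based) equal to 2(⌊n/3⌋ + 1) if n ≡ 1 (mod 3), else 1 — in Mathlib's
`GenContFract.of` (theorem in print, absent from Mathlib; Cohn's six-integral proof is the short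
road; card item S2). [difficulty: L] -/
@[route_item "route-Schanuel-MoebiusRung"]
def EulerContinuedFraction : Prop :=
  (GenContFract.of (Real.exp 1)).h = 2 ∧ ∀ n : ℕ, (GenContFract.of (Real.exp 1)).partDens.get? n = some (if n % 3 = 1 then ((2 * (n / 3 + 1) : ℕ) : ℝ) else 1)

/-- item stmt-Schanuel-5876 · support · rank 9 · closed · moot by None · by planner
sources: Davis1978, Cohn2006
[support] for every real C only finitely many q admit an integer p with |e − p/q| < C/(q² log q)
(weak, constant-free form of Davis1978: from EulerContinuedFraction, log q_n(e) ≍ n log n while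
a_{n+1}(e) ≤ n, plus Legendre's theorem `Real.exists_rat_eq_convergent`; card items (2), D).
[difficulty: M] -/
@[route_item "route-Schanuel-MoebiusRung"]
def ExpOneLogApproxFinite : Prop :=
  ∀ C : ℝ, {q : ℕ | ∃ p : ℤ, |Real.exp 1 - p / q| < C / ((q : ℝ) ^ 2 * Real.log q)}.Finite

/-- item stmt-Schanuel-5877 · support · rank 9 · closed · moot by None · by planner
sources: Khinchin1964, Raney1973
[support] if x has, for every C, only finitely many C/(q² log q)-approximations, then so does (ax +
b)/(cx + d) for integers a, b, c, d with ad − bc ≠ 0 and cx + d ≠ 0 (elementary: pull an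
approximation p/q of the image back through the inverse map; heights change by a bounded factor,
errors by a bounded factor; card lemma D in the form actually needed). [difficulty: M] -/
@[route_item "route-Schanuel-MoebiusRung"]
def MoebiusPreservesLogApproxFinite : Prop :=
  ∀ (x : ℝ) (a b c d : ℤ), a * d - b * c ≠ 0 → (c : ℝ) * x + d ≠ 0 → (∀ C : ℝ, {q : ℕ | ∃ p : ℤ, |x - p / q| < C / ((q : ℝ) ^ 2 * Real.log q)}.Finite) → ∀ C : ℝ, {q : ℕ | ∃ p : ℤ, |(a * x + b) / (c * x + d) - p / q| < C / ((q : ℝ) ^ 2 * Real.log q)}.Finite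

/-- item stmt-Schanuel-5878 · support · rank 9 · closed · moot by None · by planner
sources: Hurwitz1896, MatthewsWalters1970, HartonoKraaikamp2002, Raney1973
[support] for integers a, b, c, d with ad − bc ≠ 0 (and ce + d ≠ 0) the regular continued fraction
of (ae + b)/(ce + d) is, from some index on, an interlacing of arithmetic progressions with
natural-number coefficients (Hurwitz's 1896 theorem: the class of Hurwitz continued fractions is
stable under nonsingular integer Möbius maps, orders preserved; e is Hurwitzian of order 1 by
EulerContinuedFraction; explicit for (m/n)e^{1/q} in MatthewsWalters1970; a grounder may vendor
Hurwitz's theorem as a Literature fact and close this by citation; card item S2). [difficulty: L] -/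
@[route_item "route-Schanuel-MoebiusRung"]
def HurwitzMoebiusOfExpOne : Prop :=
  ∀ a b c d : ℤ, a * d - b * c ≠ 0 → (c : ℝ) * Real.exp 1 + d ≠ 0 → ∃ (n₀ r : ℕ) (α β : Fin r → ℕ), 0 < r ∧ ∀ (m : ℕ) (i : Fin r), (GenContFract.of ((a * Real.exp 1 + b) / (c * Real.exp 1 + d))).partDens.get? (n₀ + r * m + i) = some ((α i * m + β i : ℕ) : ℝ)

/-- item stmt-Schanuel-5879 · assembly · rank 1 · closed · moot by None · by planner
sources: Hurwitz1896, Davis1978, Raney1973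
[assembly] MoebiusFormOfRung → HurwitzMoebiusOfExpOne → ExpOneLogApproxFinite →
MoebiusPreservesLogApproxFinite → (PiNotHurwitzian ∨ PiLogApproximable) → Target (sector assembly; X
= Target is a consequence of, not a route to, Summit.Schanuel.Schanuel). -/
@[route_item "route-Schanuel-MoebiusRung"]
def Assembly : Prop :=
  MoebiusFormOfRung → HurwitzMoebiusOfExpOne → ExpOneLogApproxFinite → MoebiusPreservesLogApproxFinite → (PiNotHurwitzian ∨ PiLogApproximable) → Target

end Summit.Schanuel.Schanuel.Theses.MoebiusRung
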